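import Literature.NumberTheory.EllipticCurves.WeierstrassSchemePoints
import Literature.AlgebraicGeometry.Motives.ProjectiveSpaceLinearSubst
import HarnessLib

/-!
# The negation morphism of the Weierstrass plane cubic

For a Weierstrass curve `W` over a field `K` with plane cubic `E_W = V₊(F) ⊂ ℙ²_K`
(`WeierstrassCurve.scheme`), the negation of the chord–tangent law is induced by a *linear*
automorphism of `ℙ²`: `[X : Y : Z] ↦ [X : −Y − a₁X − a₃Z : Z]` (Silverman, *AEC* III.2.3:
`−P₀ = (x₀, −y₀ − a₁x₀ − a₃)`). This file constructs it as a morphism of `K`-schemes and computes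
it on points:

* `negSubst W` — the substitution `X ↦ X, Y ↦ −Y − a₁X − a₃Z, Z ↦ Z` (an involution fixing the
  Weierstrass cubic: `aeval_negSubst_negSubst`, `aeval_negSubst_polynomial`);
* `negProj W : ℙ²_K → ℙ²_K` — the projective linear transformation it defines
  (`Motives/ProjectiveSpaceLinearSubst.substMap`, Mathlib `Proj.map`);
* `negHom W : E_W → E_W` over `K` — its restriction to the reduced closed subscheme `E_W`
  (`Motives/HypersurfaceFieldPoints.liftOfRangeSubset`; the image stays in `V₊(F)` because the
  substitution fixes `F`), with `negHom ≫ schemeι = schemeι ≫ negProj`;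
* on points: `schemePoint v ≫ negHom = schemePoint (neg v)`, `neg v = (v₀, −v₁ − a₁v₀ − a₃v₂, v₂)` Mathlib's
  `WeierstrassCurve.Projective.neg`
  (`schemePoint_comp_negHom`) and, for `W` elliptic, **`pointEquiv P ≫ negHom = pointEquiv (−P)`**
  for Mathlib's negation on `W(L)` (`pointEquiv_comp_negHom`; AEC III.2.3), in particular in the
  form consumed by the assembly of the abelian-variety model of `W` (`pointEquiv_comp_negHom_geom`).

## References

* J. H. Silverman, *The Arithmetic of Elliptic Curves*, 2nd ed., GTM 106 (2009): III.2.3, III.3.6.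
  [SilvermanAEC2009]
* R. Hartshorne, *Algebraic Geometry* (1977): II Example 7.1.1. [Hartshorne1977]
-/

noncomputable section

open CategoryTheory AlgebraicGeometry MvPolynomial
open Literature.AlgebraicGeometry.Motives Literature.NumberTheory.EllipticCurves

universe u

namespace WeierstrassCurve

variable {K : Type u} [Field K] (W : WeierstrassCurve K)

attribute [local instance] MvPolynomial.gradedAlgebra ProjBaseChange.algebraBase

/-! ### The substitution -/

/-- The linear substitution `X ↦ X`, `Y ↦ −Y − a₁X − a₃Z`, `Z ↦ Z` inducing negation on the
Weierstrass cubic (Silverman, *AEC* III.2.3). [cite: SilvermanAEC2009, III.2.3] -/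
def negSubst : Fin 3 → MvPolynomial (Fin 3) K :=
  ![X 0, -X 1 - C W.a₁ * X 0 - C W.a₃ * X 2, X 2]

/-- `X ↦ X`. [folklore] -/
@[simp] theorem negSubst_zero : W.negSubst 0 = X 0 := rfl

/-- `Y ↦ −Y − a₁X − a₃Z`. [cite: SilvermanAEC2009, III.2.3] -/
@[simp] theorem negSubst_one : W.negSubst 1 = -X 1 - C W.a₁ * X 0 - C W.a₃ * X 2 := rfl

/-- `Z ↦ Z`. [folklore] -/
@[simp] theorem negSubst_two : W.negSubst 2 = X 2 := rfl

/-- The substitution is by linear forms. [folklore] -/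
theorem isHomogeneous_negSubst (j : Fin 3) : (W.negSubst j).IsHomogeneous 1 := by
  fin_cases j
  · exact isHomogeneous_X K 0
  · exact (((isHomogeneous_X K 1).neg).sub (isHomogeneous_C_mul_X W.a₁ 0)).sub
      (isHomogeneous_C_mul_X W.a₃ 2)
  · exact isHomogeneous_X K 2

/-- The substitution is an involution. [folklore] -/
theorem aeval_negSubst_negSubst (p : MvPolynomial (Fin 3) K) :
    aeval W.negSubst (aeval W.negSubst p) = p := by
  suffices h : (aeval W.negSubst).comp (aeval W.negSubst) = AlgHom.id K _ from
    DFunLike.congr_fun h p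
  refine MvPolynomial.algHom_ext fun j ↦ ?_
  rw [AlgHom.comp_apply, AlgHom.id_apply, aeval_X]
  fin_cases j
  · simp
  · simp only [Fin.mk_one, negSubst_one, map_sub, map_neg, map_mul, aeval_X, aeval_C,
      negSubst_zero, negSubst_two, MvPolynomial.algebraMap_eq]
    ring
  · simp

/-- **The substitution fixes the Weierstrass cubic**: `F(X, −Y − a₁X − a₃Z, Z) = F(X, Y, Z)`
(both sides equal `YZ(Y + a₁X + a₃Z) − (X³ + …)`). [cite: SilvermanAEC2009, III.2.3] -/
theorem aeval_negSubst_polynomial :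
    aeval W.negSubst W.toProjective.polynomial = W.toProjective.polynomial := by
  simp only [WeierstrassCurve.Projective.polynomial, map_sub, map_add, map_mul, map_pow, aeval_X,
    aeval_C, negSubst_zero, negSubst_one, negSubst_two, MvPolynomial.algebraMap_eq]
  ring

/-- On vectors the substitution is `v ↦ (v₀, −v₁ − a₁v₀ − a₃v₂, v₂)`. [folklore] -/
theorem substVec_negSubst {S : Type u} [Field S] [Algebra K S] (v : Fin 3 → S) :
    ProjectiveSpace.substVec (n := 2) W.negSubst v =
      ![v 0, -v 1 - algebraMap K S W.a₁ * v 0 - algebraMap K S W.a₃ * v 2, v 2] := by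
  funext j
  fin_cases j <;> simp [ProjectiveSpace.substVec_apply]

/-! ### Negated homogeneous coordinates -/

section Vec

variable {L : Type u} [Field L] [Algebra K L]

/-- Two presentations of the same homogeneous coordinates give the same point. [folklore] -/
theorem schemePoint_congr {v v' : Fin 3 → L} (h : v = v') (hv : v ≠ 0)
    (hEq : (W.baseChange L).toProjective.Equation v) (hv' : v' ≠ 0)
    (hEq' : (W.baseChange L).toProjective.Equation v') :
    W.schemePoint v hv hEq = W.schemePoint v' hv' hEq' := by
  subst h
  rfl

/-- `negSubst` on vectors is Mathlib's projective negation `neg v = (v₀, −v₁ − a₁v₀ − a₃v₂, v₂)`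
(`WeierstrassCurve.Projective.neg`, `negY`) of the base-changed curve. [folklore] -/
theorem substVec_negSubst_eq_neg (v : Fin 3 → L) :
    ProjectiveSpace.substVec (n := 2) W.negSubst v = (W.baseChange L).toProjective.neg v :=
  W.substVec_negSubst v

/-- `neg v ≠ 0` for `v ≠ 0` (named so as not to shadow the root lemma `neg_ne_zero`). [folklore] -/
theorem toProjective_neg_ne_zero {v : Fin 3 → L} (hv : v ≠ 0) : (W.baseChange L).toProjective.neg v ≠ 0 := by
  rw [← substVec_negSubst_eq_neg]
  exact ProjectiveSpace.substVec_ne_zero (n := 2) W.negSubst W.negSubst W.isHomogeneous_negSubst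
    W.aeval_negSubst_negSubst hv

/-- The negated coordinates again satisfy the Weierstrass equation (cf. Mathlib `Projective.nonsingular_neg`).
[folklore] -/
theorem toProjective_equation_neg {v : Fin 3 → L} (hEq : (W.baseChange L).toProjective.Equation v) :
    (W.baseChange L).toProjective.Equation ((W.baseChange L).toProjective.neg v) := by
  rw [← W.aeval_toProjective_polynomial_eq_zero_iff] at hEq ⊢
  rw [← substVec_negSubst_eq_neg, ← ProjectiveSpace.aeval_substGraded_eq (n := 2) W.negSubst
    W.isHomogeneous_negSubst, ProjectiveSpace.substGraded_apply, aeval_negSubst_polynomial, hEq]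

end Vec

/-! ### Negation on `ℙ²` and on `E_W` -/

/-- **Negation as a projective linear transformation of `ℙ²_K`** over `K`. [cite: SilvermanAEC2009, III.2.3] -/
def negProj : projectiveSpace 2 K ⟶ projectiveSpace 2 K :=
  ProjectiveSpace.substMap (n := 2) W.negSubst W.isHomogeneous_negSubst W.negSubst
    W.isHomogeneous_negSubst W.aeval_negSubst_negSubst

/-- `negProj` maps `V₊(F)` into itself (the substitution fixes `F`): pointwise form on `ℙ²_K`.
[folklore] -/
theorem zeroLocus_subset_preimage_negProj :
    (ProjectiveSpectrum.zeroLocus (homogeneousSubmodule (Fin 3) K) {W.toProjective.polynomial} :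
        Set (ProjectiveSpectrum (homogeneousSubmodule (Fin 3) K))) ⊆
      W.negProj.left.base ⁻¹'
        ProjectiveSpectrum.zeroLocus (homogeneousSubmodule (Fin 3) K) {W.toProjective.polynomial} := by
  intro q hq
  rw [Set.mem_preimage]
  rw [ProjectiveSpectrum.mem_zeroLocus, Set.singleton_subset_iff, SetLike.mem_coe] at hq
  change {W.toProjective.polynomial} ⊆
    ((W.negProj.left.base q).asHomogeneousIdeal : Set (MvPolynomial (Fin 3) K))
  rw [Set.singleton_subset_iff, SetLike.mem_coe]
  by_contra hF
  have hmem : q ∈ W.negProj.left ⁻¹ᵁ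
      Proj.basicOpen (homogeneousSubmodule (Fin 3) K) W.toProjective.polynomial :=
    (ProjectiveSpectrum.mem_basicOpen _ _ _).mpr hF
  erw [negProj, ProjectiveSpace.substMap_preimage_basicOpen] at hmem
  rw [ProjectiveSpace.substGraded_apply, aeval_negSubst_polynomial] at hmem
  exact (ProjectiveSpectrum.mem_basicOpen _ _ _).mp hmem hq

/-- `negProj` maps `V₊(F)` into itself (the substitution fixes `F`). [folklore] -/
theorem range_schemeι_negProj_subset :
    Set.range (W.schemeι.left ≫ W.negProj.left) ⊆ Set.range W.schemeι.left := by
  rintro _ ⟨e, rfl⟩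
  have he : W.schemeι.left e ∈ Set.range W.schemeι.left := ⟨e, rfl⟩
  rw [range_schemeι] at he ⊢
  exact W.zeroLocus_subset_preimage_negProj he

/-! ### The negation morphism of `E_W` (for `W` elliptic, so that `E_W` is reduced) -/

section Elliptic

variable [W.IsElliptic]

/-- **The negation morphism `E_W → E_W` over `K`** (Silverman, *AEC* III.2.3 / III.3.6: the
restriction of the linear automorphism `[X : Y : Z] ↦ [X : −Y − a₁X − a₃Z : Z]` of `ℙ²` to the
cubic, through the reduced induced structure). [cite: SilvermanAEC2009, III.3.6] -/
def negHom : W.scheme ⟶ W.scheme :=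
  Over.homMk (liftOfRangeSubset W.schemeι.left (W.schemeι.left ≫ W.negProj.left)
    W.range_schemeι_negProj_subset) <| by
    rw [← W.schemeι_comp_hom, liftOfRangeSubset_comp_assoc, Category.assoc]
    erw [Over.w W.negProj]

/-- The underlying morphism of `negHom` is the lift of `ι ≫ negProj` through `ι` (`rfl`). [folklore] -/
theorem negHom_left : W.negHom.left =
    liftOfRangeSubset W.schemeι.left (W.schemeι.left ≫ W.negProj.left) W.range_schemeι_negProj_subset :=
  rfl

/-- `negHom` is the restriction of `negProj`: `negHom ≫ ι = ι ≫ negProj`. [folklore] -/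
theorem negHom_comp_schemeι : W.negHom ≫ W.schemeι = W.schemeι ≫ W.negProj :=
  Over.OverMorphism.ext (by
    rw [Over.comp_left, Over.comp_left, negHom_left]
    exact liftOfRangeSubset_comp W.schemeι.left (W.schemeι.left ≫ W.negProj.left)
      W.range_schemeι_negProj_subset)

/-! ### Negation on points -/

section Points

variable {L : Type u} [Field L] [Algebra K L]

/-- **Negation on homogeneous coordinates**: `[v] ≫ negHom = [v₀ : −v₁ − a₁v₀ − a₃v₂ : v₂] = [neg v]`
(Mathlib's `Projective.neg`; Silverman, *AEC* III.2.3). [cite: SilvermanAEC2009, III.2.3] -/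
theorem schemePoint_comp_negHom (v : Fin 3 → L) (hv : v ≠ 0)
    (hEq : (W.baseChange L).toProjective.Equation v) :
    W.schemePoint v hv hEq ≫ W.negHom =
      W.schemePoint ((W.baseChange L).toProjective.neg v) (W.toProjective_neg_ne_zero hv) (W.toProjective_equation_neg hEq) := by
  apply AlgPoints.map_injective_of_mono W.schemeι
  rw [AlgPoints.map_apply, AlgPoints.map_apply, Category.assoc, negHom_comp_schemeι, ← Category.assoc]
  change AlgPoints.map W.schemeι (W.schemePoint v hv hEq) ≫ W.negProj =
    AlgPoints.map W.schemeι (W.schemePoint _ _ _)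
  rw [map_schemeι_schemePoint, map_schemeι_schemePoint, negProj,
    ProjectiveSpace.pointOfVec_comp_substMap (n := 2) W.negSubst W.isHomogeneous_negSubst W.negSubst
      W.isHomogeneous_negSubst W.aeval_negSubst_negSubst v hv
      (by rw [substVec_negSubst_eq_neg]; exact W.toProjective_neg_ne_zero hv)]
  congr 1
  exact W.substVec_negSubst_eq_neg v

/-- **`pointEquiv P ≫ negHom = pointEquiv (−P)`**: on `L`-points the negation morphism is Mathlib's
negation of `W(L)` (`O ↦ O`, `(x, y) ↦ (x, −y − a₁x − a₃)`; Silverman, *AEC* III.2.3).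
[cite: SilvermanAEC2009, III.2.3] -/
theorem pointEquiv_comp_negHom (P : (W.baseChange L).toAffine.Point) :
    W.pointEquiv P ≫ W.negHom = W.pointEquiv (-P) := by
  rcases P with _ | ⟨x, y, h⟩
  · have h0 : -(0 : (W.baseChange L).toAffine.Point) = 0 := rfl
    rw [← Affine.Point.zero_def, h0, pointEquiv_zero, schemePoint_comp_negHom]
    refine W.schemePoint_eq_of_equiv ⟨Units.mk0 (-1) (by norm_num), ?_⟩ _ _ _ _
    funext j
    fin_cases j <;> simp [Projective.neg, Projective.negY]
  · rw [Affine.Point.neg_some, pointEquiv_some, pointEquiv_some, schemePoint_comp_negHom]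
    apply schemePoint_congr
    funext j
    fin_cases j
    · simp [Projective.neg]
    · simp [Projective.neg, Projective.negY, Affine.negY]
    · simp [Projective.neg]

/-- The same on geometric points `W.geomPoints = W(K̄)` (the form consumed by
`EllipticCurves/AbelianVarietyModelOfAddHom`). [cite: SilvermanAEC2009, III.2.3] -/
theorem pointEquiv_comp_negHom_geom (P : W.geomPoints) :
    W.pointEquiv (L := AlgebraicClosure K) P ≫ W.negHom =
      W.pointEquiv (L := AlgebraicClosure K) (-P) :=
  W.pointEquiv_comp_negHom (L := AlgebraicClosure K) P

end Points

end Elliptic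

end WeierstrassCurve
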